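import Literature.AnabelianGeometry.EtaleTheta.Discharge.Sec5DivTransportAssemblyGenuine
import Literature.AnabelianGeometry.EtaleTheta.Discharge.Sec5Prop53F1OfBiKummerData
import Literature.AnabelianGeometry.EtaleTheta.FrobenioidThetaDivisorSupportQPrincipal
import HarnessLib

/-!
# [EtTh] §5, Thm. 5.7 anchor at the GENUINE data: the binder `hsplit` of the G-w5d245-2 assembly SUPPLIED by the perfect-`Φ`
# support vocabulary `Q` with F1 = `principalDivisors` (PROOF-ONLY; 0 definitions)

S. Mochizuki, *The étale theta function and its Frobenioid-theoretic manifestations*, Publ. RIMS **45** (2009)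
[MochizukiEtTh2009], proof of Thm. 5.6 p. 329 (PDF p. 103) «since `Ψ` [essentially] preserves the divisor of zeroes and poles of
`Θ̈` [cf. Proposition 5.3, (vi)], it follows … that there exist isomorphisms `γ₁ : S₁ → T₁`, `γ₂ : S₂ → T₂` …»; Prop. 5.3 (i)/(vi)
p. 325–326 (PDF pp. 99–100); Prop. 1.4 (i) p. 247 (PDF p. 21); [FrdI] Thm. 3.4 (ii)(v), Thm. 4.9, Thm. 5.2.
[cite: MochizukiEtTh2009, Thm 5.6 proof p.329 (PDF p.103)] [cite: MochizukiEtTh2009, Prop 5.3 (vi) p.326 (PDF p.100)]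

Cell abc-iut, layer L2 ([EtTh] §5), seat abc-iut-L6-d1 (gen 5), row «F1-BIRAT» (L2-lead R453), last link of the chain
`Q` vocabulary → Prop. 5.3 → Thm. 5.7 anchor.  Everything BY NAME: abc-iut-w5-d245's genuine assembly
`ThetaFrobenioid.exists_aut_div_transport_eq_of_links_ofConnectedTemperoidData` / its seeds producer
`exists_seeds_hdivcapcup_ofConnectedTemperoidData_of_isTopCharacteristic` (p448041 / p446646), this lineage's `Q` split
`DivisorSupportDataQ.exists_pullAut_split_of_principalDivisors` (p456668) and the model-case transport theorems
`BiKummerSetting.preSteps_baseEquivalent_map_of_model` / `div_iso_eq_one_of_hypotheses` / `ofConnectedTemperoidData_pre` (p458005).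

WHAT IS PROVED.
* `exists_pullAut_split_of_principalDivisors_of_pre_eq` (MODEL CASE, `h𝔉 : 𝔉.pre = ofModel …`): for a `Q`-datum `𝔖` over any
  §5 datum with the model's operations whose F1 field IS `principalDivisors 𝔉.pre A_⊚`, the split orbit equation
  `∃ g, (Ψ^Φ)^gp Z₀ = g·Z₀ ∧ (Ψ^Φ)^gp W₀ = g·W₀` from {`induced`, Prop. 5.3 (i) on primes `hc`, `hInt`, the profile `hdiv` of
  `div(Θ̈)`, cusp-Aut, a zero/pole decomposition `div(Θ̈) = Z₀·W₀⁻¹`} and the MODEL HYPOTHESES {`h`, `hD`, `hslim`, `hnd`, `hN`} —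
  F1-Ψ / F1-Aut / `hiso` no longer appear ([FrdI] Thm. 3.4 (ii)(v), Thm. 5.2);
* `hsplit_ofConnectedTemperoidData_of_principalQ` — abc-iut-w5-d245's binder `hsplit` at the genuine data over `B^temp(Π^tp_X)⁰`
  from the inputs above (`hD`/`hslim` = tree theorems); feeding it to `exists_aut_div_transport_eq_of_links_ofConnectedTemperoidData`
  gives `hdivA` at any anchor;
* `exists_seeds_hdivcapcup_ofConnectedTemperoidData_of_principalQ` — the seeds producer (`αs`, `βs`, `hdivcap₁`, `hdivcup₁`) so fed:
  the anchored Thm. 5.7 capstone's residual {seeds, hdivcap₁, hdivcup₁} becomes {`hcharN`, `induced`, `hdesc`, `htf`, `hof`} ∪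
  {`Q`-datum with F1 = `principalDivisors`, (i) on primes, `hInt`, `hdiv`, cusp-Aut, zero/pole decomposition} ∪ {`h44`, `h3`, `hnd`, `hN`}.
HONEST FRAMING: kernel-checked implications about OUR typed §5 data; the `Q`-datum at the genuine `Φ(A_⊚)` (special fibre of `Ÿ`),
`hInt` ([EtTh] §1 p.240), `hdiv` (Prop. 1.4 (i)) and cusp-Aut are NAMED inputs, not constructed/discharged here; nothing asserts a
result of [EtTh] for an actual curve; typed ≠ discharged; no side taken on [IUTchIII] Cor. 3.12.
-/

-- `(PreFrobenioidData.ofFunctor Φ F).base` is `baseFunctor F` only at default transparency (as in abc-iut-L1's files).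
set_option backward.isDefEq.respectTransparency false

namespace Literature.AnabelianGeometry.EtaleTheta

open CategoryTheory Opposite Literature.AlgebraicGeometry.Frobenioids Literature.AnabelianGeometry.SemiGraphs
  Literature.AnabelianGeometry.SemiGraphs.GaloisObjects FrobenioidThetaDivisors

universe u₀ v₀ u v w

namespace ThetaFrobenioid

/-! ### §1 MODEL CASE: the split orbit equation from a `Q`-datum with F1 = `principalDivisors` -/

section ModelCase

variable {K : Type u₀} [Field K]
  {X : SemiGraphs.TemperedArithmeticGroup.{u₀} K} {D₀ : Type u₀} [Category.{v₀} D₀]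
  {V : FrdIMonoidStub.{w}} {T₀ : RealifiedDivisorMonoids (D₀ := D₀) V} {D : Type u} [Category.{v} D]
  {VD : FrdICatStub.{u, v, w} D} {S : BiKummerSetting X T₀ D VD}
  (h : ModelFrobenioid.Hypotheses S.tf.divisorMonoid S.tf.ratFnFunctor)
  (𝔉 : ThetaFrobenioid.{w} S.C D)
  (h𝔉 : 𝔉.pre = PreFrobenioidData.ofModel S.tf.divisorMonoid S.tf.ratFnFunctor S.tf.divBNatTrans)

include h h𝔉 in
/-- **The split orbit equation `∃ g, (Ψ^Φ)^gp Z₀ = g·Z₀ ∧ (Ψ^Φ)^gp W₀ = g·W₀` in the MODEL CASE** (`h𝔉 : 𝔉.pre = ofModel …`),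
for a `Q`-datum `𝔖` whose F1 field IS `principalDivisors 𝔉.pre A_⊚`: from `induced` ([FrdI] Thm. 4.9), Prop. 5.3 (i) on primes, the
integral binder `hInt`, the profile `hdiv` of `div(Θ̈)` (Prop. 1.4 (i)), cusp-Aut and a zero/pole decomposition — over a slim base of
FSM-type with `Φ` non-dilating and a non-group-like object (F1-Ψ, F1-Aut, `hiso` DISCHARGED by p458005's model theorems).
[cite: MochizukiEtTh2009, Prop 5.3 (vi) p.326 (PDF p.100)] [cite: MochizukiFrdI2008, Thm. 3.4 (v) p.63] -/
theorem exists_pullAut_split_of_principalDivisors_of_pre_eq (hD : IsOfFSMType D) (hslim : IsSlim D)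
    (hnd : IsNonDilatingOn S.tf.divisorMonoid)
    (hN : ∃ A : S.C, ¬ (PreFrobenioidData.ofModel S.tf.divisorMonoid S.tf.ratFnFunctor S.tf.divBNatTrans).IsGroupLikeObj A)
    (Ψ : S.C ≌ S.C) (ι : Ψ.functor.obj 𝔉.Acirc ≅ 𝔉.Acirc)
    {e : 𝔉.PhiAcirc ≃* 𝔉.pre.Mon (𝔉.base.obj (Ψ.functor.obj 𝔉.Acirc))}
    (induced : (DivisorTransportStub.ofThm49 𝔉).IsInducedBy Ψ 𝔉.Acirc e)
    {𝔓 : DivisorPrimeData 𝔉} (𝔖 : DivisorSupportDataQ 𝔓) (h𝔖 : 𝔖.principal = principalDivisors 𝔉.pre 𝔉.Acirc)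
    (hc : CuspPreserved 𝔓 Ψ ι e) (hI : 𝔖.PrincipalIffIntegralDegreeZero)
    (θ : ℤ → ℚ) (s : ℤ) (hθ : ∀ j, θ (s - j) = θ j)
    (hdiv : ∀ (𝔫 : Primes 𝔉.PhiAcirc) (h𝔫 : ¬ 𝔓.IsCuspidal 𝔫), 𝔖.ord 𝔫 𝔓.divTheta = θ (𝔓.ncspEquivZ ⟨𝔫, h𝔫⟩))
    (hAc : ∀ (g : Aut 𝔉.Acirc) (𝔭 : Primes 𝔉.PhiAcirc), 𝔓.IsCuspidal (Primes.congr (𝔉.pullAut g) 𝔭) ↔ 𝔓.IsCuspidal 𝔭)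
    {Z₀ W₀ : Algebra.GrothendieckGroup 𝔉.PhiAcirc} (hZW : 𝔓.divTheta = Z₀ * W₀⁻¹)
    (hZ₀ : ∀ 𝔫, ¬ 𝔓.IsCuspidal 𝔫 → 𝔖.ord 𝔫 Z₀ = 0) (hW₀ : ∀ 𝔠, 𝔓.IsCuspidal 𝔠 → 𝔖.ord 𝔠 W₀ = 0) :
    ∃ g : Aut 𝔉.Acirc,
      ThetaFrobenioid.gpMap (psiPhi 𝔉 Ψ ι e : 𝔉.PhiAcirc →* 𝔉.PhiAcirc) Z₀ =
        ThetaFrobenioid.gpMap (𝔉.pullAut g : 𝔉.PhiAcirc →* 𝔉.PhiAcirc) Z₀ ∧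
      ThetaFrobenioid.gpMap (psiPhi 𝔉 Ψ ι e : 𝔉.PhiAcirc →* 𝔉.PhiAcirc) W₀ =
        ThetaFrobenioid.gpMap (𝔉.pullAut g : 𝔉.PhiAcirc →* 𝔉.PhiAcirc) W₀ := by
  obtain ⟨hpre, hbe, hpre', hbe'⟩ := S.preSteps_baseEquivalent_map_of_model h hD hslim hnd hN Ψ
  have hpre₁ : ∀ ⦃A B : S.C⦄ (φ : A ⟶ B), 𝔉.pre.IsPreStep φ → 𝔉.pre.IsPreStep (Ψ.functor.map φ) := by
    rw [h𝔉]; exact hpre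
  have hbe₁ : ∀ ⦃A B : S.C⦄ (φ ψ : A ⟶ B), 𝔉.pre.BaseEquivalent φ ψ →
      𝔉.pre.BaseEquivalent (Ψ.functor.map φ) (Ψ.functor.map ψ) := by
    rw [h𝔉]; exact hbe
  have hpre₁' : ∀ ⦃A B : S.C⦄ (φ : A ⟶ B), 𝔉.pre.IsPreStep φ → 𝔉.pre.IsPreStep (Ψ.inverse.map φ) := by
    rw [h𝔉]; exact hpre'
  have hbe₁' : ∀ ⦃A B : S.C⦄ (φ ψ : A ⟶ B), 𝔉.pre.BaseEquivalent φ ψ →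
      𝔉.pre.BaseEquivalent (Ψ.inverse.map φ) (Ψ.inverse.map ψ) := by
    rw [h𝔉]; exact hbe'
  have hiso : ∀ ⦃A B : S.C⦄ (c : A ≅ B), 𝔉.pre.div c.hom = 1 := by
    rw [h𝔉]; exact S.div_iso_eq_one_of_hypotheses h
  exact 𝔖.exists_pullAut_split_of_principalDivisors Ψ ι h𝔖 induced hc hpre₁ hbe₁ hpre₁' hbe₁' hiso hI θ s hθ hdiv hAc hZW hZ₀ hW₀

end ModelCase

/-! ### §2 At the genuine §5 data `ofConnectedTemperoidData …` over `B^temp(Π^tp_X)⁰`: `hdivA` and the seeds, `hsplit` SUPPLIED -/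

section ConnectedTemperoidData

variable {K : Type u₀} [Field K] {X : SemiGraphs.TemperedArithmeticGroup.{u₀} K} {D₀ : Type u₀} [Category.{v₀} D₀]
  {V : FrdIMonoidStub.{w}} {T₀ : RealifiedDivisorMonoids (D₀ := D₀) V}
  {VD : FrdICatStub.{u₀ + 1, u₀, w} (ConnectedPart (BTemp X.Pi))}
  {tf : TemperedFrobenioid T₀ (ConnectedPart (BTemp X.Pi)) VD} {hZ : tf.monoidType = MonoidType.Z}
  {hP : ∀ A : (ConnectedPart (BTemp X.Pi))ᵒᵖ, IsPerfect (tf.Φ.carrier A)}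
  {NH : Subgroup (Field.absoluteGaloisGroup K) → tf.category → ℕ+ → Prop} {A₀ : tf.category}
  {hA₀ : PreFrobenioid.IsFrobeniusTrivial tf.toElem A₀} {hA₀' : SemiGraphs.IsGaloisObj A₀.base.obj}
  {lv N : ℕ+} {T : ThetaEnvData.{max u₀ w} N}
  {pullFrac : ∀ {A A' : (BiKummerSetting.mkOfConnectedTemperoid X tf hZ hP NH A₀ hA₀ hA₀').C} (_ : A' ⟶ A),
    (BiKummerSetting.mkOfConnectedTemperoid X tf hZ hP NH A₀ hA₀ hA₀').biratUnits A →
      (BiKummerSetting.mkOfConnectedTemperoid X tf hZ hP NH A₀ hA₀ hA₀').biratUnits A'}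
  {θr : (BiKummerSetting.mkOfConnectedTemperoid X tf hZ hP NH A₀ hA₀ hA₀').biratUnits
    (BiKummerSetting.mkOfConnectedTemperoid X tf hZ hP NH A₀ hA₀ hA₀').Aodot}
  {Bl : (BiKummerSetting.mkOfConnectedTemperoid X tf hZ hP NH A₀ hA₀ hA₀').C}
  {Pl : (BiKummerSetting.mkOfConnectedTemperoid X tf hZ hP NH A₀ hA₀ hA₀').FractionPair θr Bl}
  {Rl : (BiKummerSetting.mkOfConnectedTemperoid X tf hZ hP NH A₀ hA₀ hA₀').NthRoot θr Pl lv pullFrac}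
  (h : ModelFrobenioid.Hypotheses tf.divisorMonoid tf.ratFnFunctor)
  (Q : FrobenioidTheta.ThetaSubquotientStub.{w} (ConnectedPart (BTemp X.Pi))) (odd_l : Odd (lv : ℕ))
  (R : (BiKummerSetting.mkOfConnectedTemperoid X tf hZ hP NH A₀ hA₀ hA₀').NthRoot Rl.root Rl.pair N pullFrac)
  (ιX : T.PiX ≃ₜ* X.Pi) (K' : Type w) [Field K'] (constEmb : K'ˣ →* tf.biratUnitsModel R.BN)
  (constEmb_injective : Function.Injective constEmb)
  (hinvc : ∀ g : Aut R.AN.base,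
    pull tf.divisorMonoid g.hom (ModelFrobenioid.div R.pair.num) = ModelFrobenioid.div R.pair.num)
  (hinvp : ∀ y : T.PiX, y ∈ T.PiYdd →
    pull tf.divisorMonoid ((BiKummerSetting.mkOfConnectedTemperoid X tf hZ hP NH A₀ hA₀ hA₀').galoisSurj R.AN.base
      R.αData.isGalois (ιX y)).hom (ModelFrobenioid.div R.pair.den) = ModelFrobenioid.div R.pair.den)
  (hnd : IsNonDilatingOn tf.divisorMonoid)
  (hN : ∃ A : (BiKummerSetting.mkOfConnectedTemperoid X tf hZ hP NH A₀ hA₀ hA₀').C,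
    ¬ (PreFrobenioidData.ofModel tf.divisorMonoid tf.ratFnFunctor tf.divBNatTrans).IsGroupLikeObj A)
  (Ψ : (BiKummerSetting.mkOfConnectedTemperoid X tf hZ hP NH A₀ hA₀ hA₀').C ≌
    (BiKummerSetting.mkOfConnectedTemperoid X tf hZ hP NH A₀ hA₀ hA₀').C)
  (ι : Ψ.functor.obj (ofConnectedTemperoidData h Q odd_l R ιX K' constEmb constEmb_injective hinvc hinvp).Acirc ≅
    (ofConnectedTemperoidData h Q odd_l R ιX K' constEmb constEmb_injective hinvc hinvp).Acirc)
  (φ : (ofConnectedTemperoidData h Q odd_l R ιX K' constEmb constEmb_injective hinvc hinvp).AN ⟶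
    (ofConnectedTemperoidData h Q odd_l R ιX K' constEmb constEmb_injective hinvc hinvp).Acirc)
  {eΦ : (ofConnectedTemperoidData h Q odd_l R ιX K' constEmb constEmb_injective hinvc hinvp).PhiAcirc ≃*
    (ofConnectedTemperoidData h Q odd_l R ιX K' constEmb constEmb_injective hinvc hinvp).pre.Mon
      ((ofConnectedTemperoidData h Q odd_l R ιX K' constEmb constEmb_injective hinvc hinvp).base.obj
        (Ψ.functor.obj (ofConnectedTemperoidData h Q odd_l R ιX K' constEmb constEmb_injective hinvc hinvp).Acirc))}
  (induced : (DivisorTransportStub.ofThm49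
      (ofConnectedTemperoidData h Q odd_l R ιX K' constEmb constEmb_injective hinvc hinvp)).IsInducedBy Ψ
    (ofConnectedTemperoidData h Q odd_l R ιX K' constEmb constEmb_injective hinvc hinvp).Acirc eΦ)
  -- the perfect-`Φ` support datum at `A_⊚` with F1 = the printed «image of the birational function monoid», and its binders
  {𝔓 : DivisorPrimeData (ofConnectedTemperoidData h Q odd_l R ιX K' constEmb constEmb_injective hinvc hinvp)}
  (𝔖 : DivisorSupportDataQ 𝔓)
  (h𝔖 : 𝔖.principal = principalDivisors (ofConnectedTemperoidData h Q odd_l R ιX K' constEmb constEmb_injective hinvc hinvp).pre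
    (ofConnectedTemperoidData h Q odd_l R ιX K' constEmb constEmb_injective hinvc hinvp).Acirc)
  (hc : CuspPreserved 𝔓 Ψ ι eΦ) (hI : 𝔖.PrincipalIffIntegralDegreeZero)
  (θ : ℤ → ℚ) (s : ℤ) (hθ : ∀ j, θ (s - j) = θ j)
  (hdiv : ∀ (𝔫 : Primes (ofConnectedTemperoidData h Q odd_l R ιX K' constEmb constEmb_injective hinvc hinvp).PhiAcirc)
    (h𝔫 : ¬ 𝔓.IsCuspidal 𝔫), 𝔖.ord 𝔫 𝔓.divTheta = θ (𝔓.ncspEquivZ ⟨𝔫, h𝔫⟩))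
  (hAc : ∀ (g : Aut (ofConnectedTemperoidData h Q odd_l R ιX K' constEmb constEmb_injective hinvc hinvp).Acirc)
    (𝔭 : Primes (ofConnectedTemperoidData h Q odd_l R ιX K' constEmb constEmb_injective hinvc hinvp).PhiAcirc),
    𝔓.IsCuspidal (Primes.congr ((ofConnectedTemperoidData h Q odd_l R ιX K' constEmb constEmb_injective hinvc hinvp).pullAut g) 𝔭) ↔
      𝔓.IsCuspidal 𝔭)
  {Z₀ W₀ : Algebra.GrothendieckGroup (ofConnectedTemperoidData h Q odd_l R ιX K' constEmb constEmb_injective hinvc hinvp).PhiAcirc}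
  (hZW : 𝔓.divTheta = Z₀ * W₀⁻¹)
  (hZ₀ : ∀ 𝔫, ¬ 𝔓.IsCuspidal 𝔫 → 𝔖.ord 𝔫 Z₀ = 0) (hW₀ : ∀ 𝔠, 𝔓.IsCuspidal 𝔠 → 𝔖.ord 𝔠 W₀ = 0)
  {n : ℕ}
  (hdesc : Algebra.GrothendieckGroup.of ((ofConnectedTemperoidData h Q odd_l R ιX K' constEmb constEmb_injective hinvc hinvp).pre.div
        (ofConnectedTemperoidData h Q odd_l R ιX K' constEmb constEmb_injective hinvc hinvp).sCap) ^ n =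
      AlgebraicGeometry.Frobenioids.gpMap
        ((ofConnectedTemperoidData h Q odd_l R ιX K' constEmb constEmb_injective hinvc hinvp).pre.pull
          ((ofConnectedTemperoidData h Q odd_l R ιX K' constEmb constEmb_injective hinvc hinvp).base.map φ)) Z₀ ∧
    Algebra.GrothendieckGroup.of ((ofConnectedTemperoidData h Q odd_l R ιX K' constEmb constEmb_injective hinvc hinvp).pre.div
        (ofConnectedTemperoidData h Q odd_l R ιX K' constEmb constEmb_injective hinvc hinvp).sCup) ^ n =
      AlgebraicGeometry.Frobenioids.gpMap
        ((ofConnectedTemperoidData h Q odd_l R ιX K' constEmb constEmb_injective hinvc hinvp).pre.pull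
          ((ofConnectedTemperoidData h Q odd_l R ιX K' constEmb constEmb_injective hinvc hinvp).base.map φ)) W₀)
  (htf : ∀ x y : Algebra.GrothendieckGroup
      ((ofConnectedTemperoidData h Q odd_l R ιX K' constEmb constEmb_injective hinvc hinvp).pre.Mon
        ((ofConnectedTemperoidData h Q odd_l R ιX K' constEmb constEmb_injective hinvc hinvp).base.obj
          (ofConnectedTemperoidData h Q odd_l R ιX K' constEmb constEmb_injective hinvc hinvp).AN)), x ^ n = y ^ n → x = y)
  (hof : Function.Injective
    (Algebra.GrothendieckGroup.of :
      (ofConnectedTemperoidData h Q odd_l R ιX K' constEmb constEmb_injective hinvc hinvp).pre.Mon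
          ((ofConnectedTemperoidData h Q odd_l R ιX K' constEmb constEmb_injective hinvc hinvp).base.obj
            (ofConnectedTemperoidData h Q odd_l R ιX K' constEmb constEmb_injective hinvc hinvp).AN) →
        Algebra.GrothendieckGroup
          ((ofConnectedTemperoidData h Q odd_l R ιX K' constEmb constEmb_injective hinvc hinvp).pre.Mon
            ((ofConnectedTemperoidData h Q odd_l R ιX K' constEmb constEmb_injective hinvc hinvp).base.obj
              (ofConnectedTemperoidData h Q odd_l R ιX K' constEmb constEmb_injective hinvc hinvp).AN))))

include hnd hN induced h𝔖 hc hI hθ hdiv hAc hZW hZ₀ hW₀ in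
/-- **`hsplit` at the genuine §5 data SUPPLIED** by the `Q`-datum with F1 = `principalDivisors` (base of FSM-type / slim =
tree theorems over `B^temp(Π^tp_X)⁰`). [cite: MochizukiEtTh2009, Prop 5.3 (vi) p.326 (PDF p.100)] -/
theorem hsplit_ofConnectedTemperoidData_of_principalQ :
    ∃ g : Aut (ofConnectedTemperoidData h Q odd_l R ιX K' constEmb constEmb_injective hinvc hinvp).Acirc,
      ThetaFrobenioid.gpMap
          (psiPhi (ofConnectedTemperoidData h Q odd_l R ιX K' constEmb constEmb_injective hinvc hinvp) Ψ ι eΦ :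
            (ofConnectedTemperoidData h Q odd_l R ιX K' constEmb constEmb_injective hinvc hinvp).PhiAcirc →*
              (ofConnectedTemperoidData h Q odd_l R ιX K' constEmb constEmb_injective hinvc hinvp).PhiAcirc) Z₀ =
        ThetaFrobenioid.gpMap
          ((ofConnectedTemperoidData h Q odd_l R ιX K' constEmb constEmb_injective hinvc hinvp).pullAut g :
            (ofConnectedTemperoidData h Q odd_l R ιX K' constEmb constEmb_injective hinvc hinvp).PhiAcirc →*
              (ofConnectedTemperoidData h Q odd_l R ιX K' constEmb constEmb_injective hinvc hinvp).PhiAcirc) Z₀ ∧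
      ThetaFrobenioid.gpMap
          (psiPhi (ofConnectedTemperoidData h Q odd_l R ιX K' constEmb constEmb_injective hinvc hinvp) Ψ ι eΦ :
            (ofConnectedTemperoidData h Q odd_l R ιX K' constEmb constEmb_injective hinvc hinvp).PhiAcirc →*
              (ofConnectedTemperoidData h Q odd_l R ιX K' constEmb constEmb_injective hinvc hinvp).PhiAcirc) W₀ =
        ThetaFrobenioid.gpMap
          ((ofConnectedTemperoidData h Q odd_l R ιX K' constEmb constEmb_injective hinvc hinvp).pullAut g :
            (ofConnectedTemperoidData h Q odd_l R ιX K' constEmb constEmb_injective hinvc hinvp).PhiAcirc →*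
              (ofConnectedTemperoidData h Q odd_l R ιX K' constEmb constEmb_injective hinvc hinvp).PhiAcirc) W₀ := by
  haveI := X.secondCountableTopology
  exact exists_pullAut_split_of_principalDivisors_of_pre_eq (S := BiKummerSetting.mkOfConnectedTemperoid X tf hZ hP NH A₀ hA₀ hA₀')
    h _ (ofConnectedTemperoidData_pre h Q odd_l R ιX K' constEmb constEmb_injective hinvc hinvp)
    QuasiTemperoid.BTempConnected.connectedPart_isOfFSMType (TemperedArithmeticGroup.isSlim_connectedPart X) hnd hN Ψ ι induced 𝔖
    h𝔖 hc hI θ s hθ hdiv hAc hZW hZ₀ hW₀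

include hnd hN induced h𝔖 hc hI hθ hdiv hAc hZW hZ₀ hW₀ hdesc htf hof in
/-- **The seeds `αs, βs` and `hdivcap₁`/`hdivcup₁` of the anchored Thm. 5.7 capstone, `hdivA` DISCHARGED by the assembly and its
`hsplit` SUPPLIED by the `Q`-datum** (`Ψ := h44.Ψ`; abc-iut-w5-d245's `exists_seeds_hdivcapcup_ofConnectedTemperoidData_of_isTopCharacteristic`
fed with its `exists_aut_div_transport_eq_of_links_ofConnectedTemperoidData` at `hsplit := hsplit_ofConnectedTemperoidData_of_principalQ …`
— the same substitution gives `hdivA` at any single anchor `α`).  Residual: `induced` (Thm. 4.9 at `A_⊚`), `hdesc` (LINK (b)),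
`htf`/`hof`, the `Q`-datum with F1 = `principalDivisors` and its binders {(i) on primes, `hInt`, `hdiv`, cusp-Aut, zero/pole
decomposition}, `hcharN`, `h44`/`h3`, and the model hypotheses {`h`, `hnd`, `hN`}.
[cite: MochizukiEtTh2009, Thm 5.6 proof p.329 (PDF p.103); Thm 5.10 (i) p.333 (PDF p.107); Prop 5.3 (vi) p.326 (PDF p.100)] -/
theorem exists_seeds_hdivcapcup_ofConnectedTemperoidData_of_principalQ
    (h44 : BiKummerSetting.Thm44Hyp (BiKummerSetting.mkOfConnectedTemperoid X tf hZ hP NH A₀ hA₀ hA₀')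
      (BiKummerSetting.mkOfConnectedTemperoid X tf hZ hP NH A₀ hA₀ hA₀'))
    (hΨ : h44.Ψ = Ψ) (h3 : h44.PreservesFrobeniusStructure)
    (hcharN : IsTopCharacteristic X.Pi (galoisSurjOf X.isTempered R.AN.base.obj R.αData.isGalois).ker) :
    ∃ (αs : Ψ.functor.obj (ofConnectedTemperoidData h Q odd_l R ιX K' constEmb constEmb_injective hinvc hinvp).AN ≅
        (ofConnectedTemperoidData h Q odd_l R ιX K' constEmb constEmb_injective hinvc hinvp).AN)
      (βs : Ψ.functor.obj (ofConnectedTemperoidData h Q odd_l R ιX K' constEmb constEmb_injective hinvc hinvp).BN ≅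
        (ofConnectedTemperoidData h Q odd_l R ιX K' constEmb constEmb_injective hinvc hinvp).BN),
      αs.inv ≫ Ψ.functor.map (ofConnectedTemperoidData h Q odd_l R ιX K' constEmb constEmb_injective hinvc hinvp).sCap ≫ βs.hom =
        (ofConnectedTemperoidData h Q odd_l R ιX K' constEmb constEmb_injective hinvc hinvp).sCap ∧
      (ofConnectedTemperoidData h Q odd_l R ιX K' constEmb constEmb_injective hinvc hinvp).pre.div
          (αs.inv ≫ Ψ.functor.map (ofConnectedTemperoidData h Q odd_l R ιX K' constEmb constEmb_injective hinvc hinvp).sCap ≫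
            βs.hom) =
        (ofConnectedTemperoidData h Q odd_l R ιX K' constEmb constEmb_injective hinvc hinvp).pre.div
          (ofConnectedTemperoidData h Q odd_l R ιX K' constEmb constEmb_injective hinvc hinvp).sCap ∧
      (ofConnectedTemperoidData h Q odd_l R ιX K' constEmb constEmb_injective hinvc hinvp).pre.div
          (αs.inv ≫ Ψ.functor.map (ofConnectedTemperoidData h Q odd_l R ιX K' constEmb constEmb_injective hinvc hinvp).sCup ≫
            βs.hom) =
        (ofConnectedTemperoidData h Q odd_l R ιX K' constEmb constEmb_injective hinvc hinvp).pre.div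
          (ofConnectedTemperoidData h Q odd_l R ιX K' constEmb constEmb_injective hinvc hinvp).sCup := by
  subst hΨ
  exact exists_seeds_hdivcapcup_ofConnectedTemperoidData_of_isTopCharacteristic h Q odd_l R ιX K' constEmb constEmb_injective hinvc
    hinvp h44 hnd h3 hcharN fun α =>
      exists_aut_div_transport_eq_of_links_ofConnectedTemperoidData h Q odd_l R ιX K' constEmb constEmb_injective hinvc hinvp h44.Ψ
        ι φ induced Z₀ W₀
        (hsplit_ofConnectedTemperoidData_of_principalQ h Q odd_l R ιX K' constEmb constEmb_injective hinvc hinvp hnd hN h44.Ψ ι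
          induced 𝔖 h𝔖 hc hI θ s hθ hdiv hAc hZW hZ₀ hW₀)
        hdesc htf hof α

end ConnectedTemperoidData

end ThetaFrobenioid

end Literature.AnabelianGeometry.EtaleTheta
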